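import Summits.HubbardSuperconductivity.HubbardSuperconductivity.Theorems.AnisotropyChordTransferFibre3RowCExpr
import Summits.HubbardSuperconductivity.HubbardSuperconductivity.Theorems.AnisotropyChordTransferFibre3RowCXSCells
import Summits.HubbardSuperconductivity.HubbardSuperconductivity.Theorems.AnisotropyChordTransferFibre3N1RowCellSound
import Summits.HubbardSuperconductivity.HubbardSuperconductivity.Theorems.AnisotropyChordTransferFibre3Cs2Fold
import Summits.HubbardSuperconductivity.HubbardSuperconductivity.Theorems.AnisotropyChordTransferFibre3RowCCellSound
import Summits.HubbardSuperconductivity.HubbardSuperconductivity.Theorems.AnisotropyChordTransferFibre3ManifoldA64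
import Summits.HubbardSuperconductivity.HubbardSuperconductivity.Theorems.AnisotropyChordTransferFibre3L2TCell
import Summits.HubbardSuperconductivity.HubbardSuperconductivity.Theorems.AnisotropyChordTransferFibre3RowCTExpr

/-!
# Route `AnisotropyChord` / H0 rotor rung, row C (KT-2b) on the t-BLOCKS `64 ≤ L < 128`: block twin of `…AnisotropyChordTransferFibre3RowCCellSound`

T-FORK (p1 g32, route-lead ruling R4-b; p2's inventory memo HOME/hubbard-h0-rotor-p2/TBLOCK-INVENTORY-g8.md §3–§4): the declarations of
`…RowCCellSound` that carry the hypothesis `128 ≤ L` (or a constant that changes below `L = 128`, or the `L2.NamedCell` cell box) restated in the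
namespace `RowC.T` with the SAME names for the t-blocks (route-lead ruling R1): analytic layer with `64 ≤ L` and the `L ≥ 64` numerics of p2 g8
(`ManifoldA.nu_ceiling64` (ν < .0359), `manifold_band64`, `second_shell_window64` (±.0012/±.003), `RowC.fmax_uniform64`/`gmin_uniform64`
(same constant .07 + .1ν), `third_shell_window64` (±.0031/±.01), `window_k10_64` ([.24993, .25]), `lam_increment_bound64` (δ = .0022)); cell layer on
block cells `c : L2.TCell` (`cellFinalBoxCB (c.box a₁ a₂)`, `pmem_xTrueT`, `RowC.finalVec_mem_of_cellFinalBoxT`).  Declarations that do not change are NOT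
duplicated (they resolve to `RowC`); proofs are verbatim up to the substitutions.
Prover seat `hubbard-h0-rotor-p1` g32 (route lead); helper for piece A = stmt-HubbardSuperconductivity-23918 of rung 19089 (`--supports`, helper
class).  Nothing here proves superconductivity in the Hubbard model; lemmas for ONE row of ONE conditional reduction on the t-blocks; the rotor TARGET
as originally worded stays FALSE (g15 verdict).  Mathlib + the tree only; no sorry.
-/

set_option linter.dupNamespace false
set_option autoImplicit false

open Literature.Analysis.ValidatedNumerics

namespace Summit.HubbardSuperconductivity.HubbardSuperconductivity.Theorems.AnisotropyChord.Transfer.Fibre3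

namespace RowC

namespace T

open L2.N1

variable (L : ℕ) [NeZero L]

/-- membership of the extended vector in the extended box. [folklore] -/
theorem extVec_mem (c : L2.TCell) {F : Box} (hF : F.length = 10) {y : ℕ → ℝ} (hy : F.mem y) {x4 k11 k20 : ℝ}
    (h4 : ((c.bS2.1 : ℚ) : ℝ) ≤ x4 ∧ x4 ≤ ((c.bS2.2 : ℚ) : ℝ))
    (h11 : ((k11I.1 : ℚ) : ℝ) ≤ k11 ∧ k11 ≤ ((k11I.2 : ℚ) : ℝ))
    (h20 : ((k20I.1 : ℚ) : ℝ) ≤ k20 ∧ k20 ≤ ((k20I.2 : ℚ) : ℝ)) :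
    (rowCBox c F).mem (extVec y x4 k11 k20) := by
  intro i
  unfold rowCBox extVec Box.ivl
  by_cases hi : i < 10
  · rw [if_pos hi, List.getD_eq_getElem?_getD, List.getElem?_append_left (by omega), ← List.getD_eq_getElem?_getD]
    exact hy i
  rw [if_neg hi, List.getD_eq_getElem?_getD, List.getElem?_append_right (by omega), hF]
  by_cases h10 : i = 10
  · subst h10; simpa using h4
  by_cases h11' : i = 11
  · subst h11'; simpa using h11
  by_cases h12 : i = 12
  · subst h12; simpa using h20
  rw [if_neg h10, if_neg h11', if_neg h12]
  have : [c.bS2, k11I, k20I][i - 10]?.getD (0, 0) = (0, 0) := by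
    rw [List.getElem?_eq_none (by simp; omega)]; rfl
  rw [this]; simp


/-- the two second-shell window values of the ground profile lie in the rational intervals `k11I`, `k20I` (`L ≥ 128`). [folklore] -/
theorem window_k11_k20 (hL : 64 ≤ L) {Δ lam2 : ℝ} {f : Tor L → ℝ} (hΔ0 : 0 ≤ Δ) (hΔ1 : Δ < 1)
    (hf : IsGroundTwoMagnon L Δ lam2 f) :
    (((k11I.1 : ℚ) : ℝ) ≤ aKer L lam2 (ex L + ey L) ∧ aKer L lam2 (ex L + ey L) ≤ ((k11I.2 : ℚ) : ℝ)) ∧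
    (((k20I.1 : ℚ) : ℝ) ≤ aKer L lam2 (ex L + ex L) ∧ aKer L lam2 (ex L + ex L) ≤ ((k20I.2 : ℚ) : ℝ)) := by
  have hLpos : (0 : ℝ) < L := by exact_mod_cast (show 0 < L by omega)
  have hπ := Real.pi_pos
  set θ : ℝ := 2 * Real.pi / L with hθ
  have ht0 : 0 < θ ^ 2 := by positivity
  have hlam : 0 < lam2 := lam2_pos L (by omega) hΔ1 hf.1
  have hνc := ManifoldA.nu_ceiling64 L hL hΔ0 hf
  have hν0 : 0 ≤ lam2 / θ ^ 2 := by positivity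
  have hν5 : lam2 / θ ^ 2 ≤ 0.0513 := by
    rw [div_le_iff₀ ht0, hθ]
    have hx0 : 0 ≤ (2 * Real.pi / (L : ℝ)) ^ 2 := sq_nonneg _
    linarith [hνc]
  have hlamθ : lam2 = lam2 / θ ^ 2 * (2 * Real.pi / L) ^ 2 := by rw [hθ]; field_simp
  obtain ⟨hw11, hw20⟩ := ManifoldA.second_shell_window64 L hL (lam2 / θ ^ 2) hν0 hν5
  rw [← hlamθ] at hw11 hw20
  have e11 : ((((1 : ℤ)) : ZMod L), (((1 : ℤ)) : ZMod L)) = ex L + ey L := by unfold ex ey; ext <;> simp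
  have e20 : ((((2 : ℤ)) : ZMod L), (((0 : ℤ)) : ZMod L)) = ex L + ex L := by
    unfold ex; ext <;> simp
    norm_num
  rw [e11] at hw11
  rw [e20] at hw20
  obtain ⟨hp1, hp2⟩ := inv_pi_bounds
  obtain ⟨hl1, hh1⟩ := abs_le.mp hw11
  obtain ⟨hl2, hh2⟩ := abs_le.mp hw20
  have e2 : 2 / Real.pi = 2 * (1 / Real.pi) := by ring
  rw [e2] at hl2 hh2
  unfold k11I k20I
  push_cast
  exact ⟨⟨by linarith, by linarith⟩, ⟨by linarith, by linarith⟩⟩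


end T

end RowC

end Summit.HubbardSuperconductivity.HubbardSuperconductivity.Theorems.AnisotropyChord.Transfer.Fibre3
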